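import Mathlib
import Summits.Ventures.PercRepro2.Tail2DBlockCalc
import Summits.Ventures.PercRepro2.Tail2DHarrisSP
import Summits.Ventures.PercRepro2.Tail2DFlowOneBlocks
import Summits.Ventures.PercRepro2.Tail2DFlowOneStep01
import Summits.Ventures.PercRepro2.Tail2DParFin
import Summits.Ventures.PercRepro2.Tail2DParFinFlip
import Summits.Ventures.PercRepro2.Tail2DParFinTop
import Summits.Ventures.PercRepro2.Tail2DParFinDiag
import Summits.Ventures.PercRepro2.Tail2DParFinCount
import Summits.Ventures.PercRepro2.Tail2DParFinRelax
import Summits.Ventures.PercRepro2.Tail2DParFinSubTop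
import Summits.Ventures.PercRepro2.Tail2DParFinSubTopB
import Summits.Ventures.PercRepro2.Tail2DOneChange
import Summits.Ventures.PercRepro2.Tail2DOneChangeB

/-!
# The one-change certificate with arbitrary rate tables, part III: the target identity and the theorem
(seat mine-b, cell pub-perc-repro2; conjectures/MINE-B.md §44)

**`sdomZ_of_oneChange`**: for any position `(u, v)` (`1 ≤ u`) on `X₀ ∥ … ∥ X_{k−1}` (flow-one factors with red
crossings), a rate table `R : OCRates k` with non-negative rates satisfying the source identity `R.SrcOK X u v`
and the target identity `R.TgtOK X u v` — every word `w` of the target tail receives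
`[w common] ι w + Σ_{j blue} (f(w[j→R], j) + [w[j→R] common] x(w[j→R], j)) + Σ_{l ∈ C} x(w[l→R], l)
= |E(u,v)| / |E(u−1,v+1)|` — proves `SDomZ (parFin k X) u v`.  The sub-top certificate is the instance
`ι = λ − (v+1)/(u+1)`, `x = λ − (v+1)/u`, `f` as in Tail2DParFinSubTop; every further position of the family is
landed by exhibiting its table and verifying the two identities.
-/

namespace Summit.Ventures.PercRepro2.Tail2D

open V2Closure Finset

/-- **the target identity of a rate table**: every word of the target tail receives `λ` -/
def OCRates.TgtOK {k : ℕ} (R : OCRates k) (X : Fin k → V2Closure.SP) (u v : ℕ) : Prop :=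
  ∀ w0 : Fin k → Ltr, (u - 1 ≤ nR k w0 ∧ v + 1 ≤ nB k w0) →
    (if ocCom k u v w0 then R.ι w0 else 0)
      + ∑ j ∈ blueSet k w0, (R.f (Function.update w0 j Ltr.R) j
          + (if ocCom k u v (Function.update w0 j Ltr.R) then R.x (Function.update w0 j Ltr.R) j else 0))
      + ∑ l ∈ cSet k w0, R.x (Function.update w0 l Ltr.R) l
      = (tailCount (parFin k X) u v : ℚ) / (tailCount (parFin k X) (u - 1) (v + 1) : ℚ)

/-- the rate received by a word, for a rate table (the three slices summed) -/
noncomputable def ocTRate (k : ℕ) (u v : ℕ) (R : OCRates k) (w0 : Fin k → Ltr) : ℚ :=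
  ∑ i, ((if ocCom k u v w0 then R.ι w0 / k else 0)
    + (if w0 i = Ltr.B ∧ ocSrc k u v (Function.update w0 i Ltr.R) then R.f (Function.update w0 i Ltr.R) i else 0)
    + (if (w0 i = Ltr.B ∨ w0 i = Ltr.C) ∧ ocCom k u v (Function.update w0 i Ltr.R)
        then R.x (Function.update w0 i Ltr.R) i else 0))

section OCTheorem

variable {k : ℕ} {X : Fin k → V2Closure.SP} {u v : ℕ}

/-- a word receiving a flip or a relax, or keeping its identity, is in the target tail -/
theorem oc_tgt_of_term (w0 : Fin k → Ltr) (i : Fin k)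
    (h : ocCom k u v w0 ∨ (w0 i = Ltr.B ∧ ocSrc k u v (Function.update w0 i Ltr.R))
      ∨ ((w0 i = Ltr.B ∨ w0 i = Ltr.C) ∧ ocCom k u v (Function.update w0 i Ltr.R))) :
    u - 1 ≤ nR k w0 ∧ v + 1 ≤ nB k w0 := by
  rcases h with h | ⟨hB, hs⟩ | ⟨hBC, hc⟩
  · have := h.1.1; have := h.2; omega
  · have e1 := nR_update_R k w0 i (by rw [hB]; exact Ltr.noConfusion)
    have e2 := nB_update_R_of_B k w0 i hB
    have := hs.1; have := hs.2; omega
  · have e1 := nR_update_R k w0 i (by rcases hBC with h | h <;> rw [h] <;> exact Ltr.noConfusion)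
    have hn := hc.1.1
    have hb := hc.2
    rcases hBC with h | h
    · have e2 := nB_update_R_of_B k w0 i h; omega
    · have e2 := nB_update_R_of_ne k w0 i (by rw [h]; exact Ltr.noConfusion); omega

/-- **the rate received by every word**, from the target identity: `λ` on the target tail, `0` elsewhere -/
theorem ocTRate_eq (R : OCRates k) (htgt : R.TgtOK X u v) (hk : 1 ≤ k) (w0 : Fin k → Ltr) :
    ocTRate k u v R w0 = if (u - 1 ≤ nR k w0 ∧ v + 1 ≤ nB k w0)
      then (tailCount (parFin k X) u v : ℚ) / (tailCount (parFin k X) (u - 1) (v + 1) : ℚ) else 0 := by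
  have hkpos : (0 : ℚ) < k := by exact_mod_cast (show 0 < k by omega)
  unfold ocTRate
  by_cases ht : u - 1 ≤ nR k w0 ∧ v + 1 ≤ nB k w0
  · rw [if_pos ht, ← htgt w0 ht]
    simp only [Finset.sum_add_distrib]
    -- the identity slice
    have hA : ∑ i : Fin k, (if ocCom k u v w0 then R.ι w0 / k else 0) = if ocCom k u v w0 then R.ι w0 else 0 := by
      by_cases hc : ocCom k u v w0
      · simp only [if_pos hc, Finset.sum_const, Finset.card_univ, Fintype.card_fin, nsmul_eq_mul]
        field_simp
      · simp only [if_neg hc, Finset.sum_const_zero]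
    -- the flip slice: every blue position's unflip is a source word
    have hB : ∀ i, (if w0 i = Ltr.B ∧ ocSrc k u v (Function.update w0 i Ltr.R)
        then R.f (Function.update w0 i Ltr.R) i else 0)
        = if w0 i = Ltr.B then R.f (Function.update w0 i Ltr.R) i else 0 := by
      intro i
      by_cases hi : w0 i = Ltr.B
      · have e1 := nR_update_R k w0 i (by rw [hi]; exact Ltr.noConfusion)
        have e2 := nB_update_R_of_B k w0 i hi
        rw [if_pos ⟨hi, ⟨by omega, by omega⟩⟩, if_pos hi]
      · rw [if_neg (fun h => hi h.1), if_neg hi]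
    -- the relax slice: blue positions with a common unflip, and every `C` position
    have hC : ∀ i, (if (w0 i = Ltr.B ∨ w0 i = Ltr.C) ∧ ocCom k u v (Function.update w0 i Ltr.R)
        then R.x (Function.update w0 i Ltr.R) i else 0)
        = (if w0 i = Ltr.B then (if ocCom k u v (Function.update w0 i Ltr.R)
            then R.x (Function.update w0 i Ltr.R) i else 0) else 0)
          + (if w0 i = Ltr.C then R.x (Function.update w0 i Ltr.R) i else 0) := by
      intro i
      cases hi : w0 i
      · simp
      · simp
      · have e1 := nR_update_R k w0 i (by rw [hi]; exact Ltr.noConfusion)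
        have e2 := nB_update_R_of_ne k w0 i (by rw [hi]; exact Ltr.noConfusion)
        have hc : ocCom k u v (Function.update w0 i Ltr.R) := ⟨⟨by omega, by omega⟩, by omega⟩
        simp [hc]
    simp only [hB, hC, hA, Finset.sum_add_distrib]
    have hS1 : ∑ i, (if w0 i = Ltr.B then R.f (Function.update w0 i Ltr.R) i else 0)
        = ∑ j ∈ blueSet k w0, R.f (Function.update w0 j Ltr.R) j := by
      rw [← Finset.sum_filter]; rfl
    have hS2 : ∑ i, (if w0 i = Ltr.B then (if ocCom k u v (Function.update w0 i Ltr.R)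
          then R.x (Function.update w0 i Ltr.R) i else 0) else 0)
        = ∑ j ∈ blueSet k w0, (if ocCom k u v (Function.update w0 j Ltr.R)
          then R.x (Function.update w0 j Ltr.R) j else 0) := by
      rw [← Finset.sum_filter]; rfl
    have hS3 : ∑ i, (if w0 i = Ltr.C then R.x (Function.update w0 i Ltr.R) i else 0)
        = ∑ l ∈ cSet k w0, R.x (Function.update w0 l Ltr.R) l := by
      rw [← Finset.sum_filter]; rfl
    rw [hS1, hS2, hS3]
    ring
  · rw [if_neg ht]
    apply Finset.sum_eq_zero
    intro i _
    rw [if_neg (fun h => ht (oc_tgt_of_term w0 i (Or.inl h))),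
      if_neg (fun h => ht (oc_tgt_of_term w0 i (Or.inr (Or.inl h)))),
      if_neg (fun h => ht (oc_tgt_of_term w0 i (Or.inr (Or.inr h))))]
    ring

/-- **the target coverage of a one-change certificate** -/
theorem oc_tgt_cov (hX : ∀ i, FlowOne (X i)) (R : OCRates k) (htgt : R.TgtOK X u v) (hk : 1 ≤ k)
    (hE : 0 < tailCount (parFin k X) u v) (hE' : 0 < tailCount (parFin k X) (u - 1) (v + 1))
    (z : (parFin k X).Conf) :
    ∑ p : (Fin k → Ltr) × Fin k × Fin 3,
      ocW k X u v R p.1 p.2.1 p.2.2 * unifDens (parFin k X) (ocQ k X u v p.1 p.2.1 p.2.2) z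
      = unifDens (parFin k X) (tailSet (parFin k X) (u - 1) (v + 1)) z := by
  set w0 := wordOf k X z with hw0
  set E : ℚ := (tailCount (parFin k X) u v : ℚ) with hE0
  set E' : ℚ := (tailCount (parFin k X) (u - 1) (v + 1) : ℚ) with hE'0
  have hEpos : 0 < E := by rw [hE0]; exact_mod_cast hE
  have hE'pos : 0 < E' := by rw [hE'0]; exact_mod_cast hE'
  have hRHS : unifDens (parFin k X) (tailSet (parFin k X) (u - 1) (v + 1)) z
      = if (u - 1 ≤ nR k w0 ∧ v + 1 ≤ nB k w0) then E'⁻¹ else 0 := by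
    unfold unifDens
    rw [hE'0, tailCount_eq_card]
    by_cases h : z ∈ tailSet (parFin k X) (u - 1) (v + 1)
    · rw [if_pos h, if_pos ((mem_tailSet_parFin k X hX (u - 1) (v + 1) z).1 h)]
    · rw [if_neg h, if_neg (fun hh => h ((mem_tailSet_parFin k X hX (u - 1) (v + 1) z).2 hh))]
  rw [hRHS, Fintype.sum_prod_type]
  simp only [oc_tgt_term hX R]
  rw [Finset.sum_comm, Fintype.sum_prod_type]
  simp only [Fin.sum_univ_three, sum_ocTerm_zero, sum_ocTerm_one, sum_ocTerm_two]
  have hdiv : ∀ (c : Prop) [Decidable c] (a : ℚ), (if c then a / E else 0) = (if c then a else 0) / E := by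
    intro c _ a; split_ifs <;> simp
  simp only [← hw0, ← hE0]
  simp only [hdiv, ← add_div, ← Finset.sum_div]
  have := ocTRate_eq R htgt hk w0
  unfold ocTRate at this
  rw [this, ← hE0, ← hE'0]
  by_cases ht : u - 1 ≤ nR k w0 ∧ v + 1 ≤ nB k w0
  · rw [if_pos ht, if_pos ht]
    field_simp
  · rw [if_neg ht, if_neg ht, zero_div]

/-- **(SD) from a one-change certificate**: non-negative rates with the source and target identities -/
theorem sdomZ_of_oneChange (hX : ∀ i, FlowOne (X i)) (hR : ∀ i, 0 < (rSet (X i)).card) (hu : 1 ≤ u)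
    (R : OCRates k) (hι : ∀ w, 0 ≤ R.ι w) (hf : ∀ w i, 0 ≤ R.f w i) (hx : ∀ w i, 0 ≤ R.x w i)
    (hsrc : R.SrcOK X u v) (htgt : R.TgtOK X u v) : SDomZ (parFin k X) (u : ℤ) (v : ℤ) := by
  rw [sdomZ_iff_blockDom]
  have e1 : ((u : ℤ)).toNat = u := by omega
  have e2 : ((v : ℤ)).toNat = v := by omega
  have e3 : ((u : ℤ) - 1).toNat = u - 1 := by omega
  have e4 : ((v : ℤ) + 1).toNat = v + 1 := by omega
  rw [e1, e2, e3, e4]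
  -- the degenerate cases: an empty source or target tail
  by_cases hE : tailCount (parFin k X) u v = 0
  · intro f _
    rw [tailCount_eq_card] at hE
    have : tailSet (parFin k X) u v = ∅ := Finset.card_eq_zero.1 hE
    unfold blockSum
    rw [this, Finset.sum_empty, zero_mul]
    exact Nat.zero_le _
  by_cases hE' : tailCount (parFin k X) (u - 1) (v + 1) = 0
  · intro f _
    rw [tailCount_eq_card] at hE'
    rw [hE', mul_zero]
    exact Nat.zero_le _
  have hk : 1 ≤ k := by
    by_contra hk
    have hk0 : k = 0 := by omega
    subst hk0
    -- with no factors the red label is `0 < u`: the source tail is empty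
    apply hE
    rw [tailCount_eq_card, Finset.card_eq_zero, Finset.eq_empty_iff_forall_notMem]
    intro z hz
    have := ((mem_tailSet_parFin 0 X hX u v z).1 hz).1
    have h0 : nR 0 (wordOf 0 X z) = 0 := by
      unfold nR; simp
    omega
  exact blockDom_of_mixture (parFin k X) (fun p : (Fin k → Ltr) × Fin k × Fin 3 => ocP k X u v p.1 p.2.1 p.2.2)
    (fun p => ocQ k X u v p.1 p.2.1 p.2.2) (fun p => ocW k X u v R p.1 p.2.1 p.2.2)
    (fun p => ocW_nonneg R hι hf hx p.1 p.2.1 p.2.2) (fun p => ocP_dom hX p.1 p.2.1 p.2.2)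
    (fun p => ocQ_nonempty hX hR R p.1 p.2.1 p.2.2) _ _ (oc_src_cov hX hR R hsrc hk)
    (oc_tgt_cov hX R htgt hk (Nat.pos_of_ne_zero hE) (Nat.pos_of_ne_zero hE'))

end OCTheorem

end Summit.Ventures.PercRepro2.Tail2D
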